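import Literature.Probability.RandomPlanarGeometry.HexParafermionTransport
import HarnessLib

/-!
# One of the two other neighbours of an adjacent target is a far port (line `Sketch`)

Stub `stub_exists_farPort` (S4, a lattice fact) of the checked skeleton of line `Sketch`
(adjacent-port reduction) for the crux `SpinMonotone` (stmt-CriticalPhenomena-16769), namespace of
the skeleton.

**What.** On the honeycomb lattice `hexGraph` (vertices `HexVertex`), let `u ∼ w ∼ v` with `u ≠ v`
(the boundary mid-edge `{u, w}` and a target `v` adjacent to its source vertex `w`), and let `p ≠ q`
be the two neighbours of `v` other than `w`. Then `u` reaches `p` or `q` by a lattice path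
`u – x – y – (p or q)` of length `3` whose first step `x` is not `w` (the far port: `u, w, v`, the
port and that path bound one hexagon).

**How.** The chart `exists_chart` of `HexParafermionTransport` (dart transitivity of the honeycomb
lattice) maps the dart `u → w` to the standard entrance dart `wOut → hvOrigin` of the coordinate
model `hvGraph` on `HV = ℤ × ℤ × Bool` by a graph isomorphism `Φ`; adjacency and distinctness are
transported by `Φ.map_rel_iff` and `Φ.injective`. In coordinates `Φ v` is one of the two
neighbours `(0, 0, true)`, `(-1, 0, true)` of `hvOrigin = (0, 0, false)` other than
`wOut = (0, -1, true)`, and `Φ p`, `Φ q` are its two neighbours other than `hvOrigin`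
(`hvGraph_adj_iff_mem_nbrs`, `HV.nbrs`); the explicit `3`-paths
`wOut – (1, -1, false) – (1, -1, true) – (1, 0, false)` and
`wOut – (0, -1, false) – (-1, -1, true) – (-1, 0, false)` (checked by `decide`) reach one of them,
and are pulled back along `Φ.symm`.

Sources: folklore (the honeycomb lattice and its coordinate model, `HexSAWLattice.lean`).
-/

noncomputable section

namespace Summit.CriticalPhenomena.SAWScalingLimit.Cruxes.SpinMonotone.AdjacentPort

open Literature.Probability.LatticeModels
open Literature.Probability.RandomPlanarGeometry Literature.Probability.RandomPlanarGeometry.SAW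
open Literature.Probability.RandomPlanarGeometry.SAW.HV

/-- Coordinate core at the standard entrance dart `wOut → hvOrigin`: if `v ≠ wOut` is a neighbour
of `hvOrigin` and `p ≠ q` are neighbours of `v` other than `hvOrigin`, then a `3`-path from `wOut`
whose first step avoids `hvOrigin` reaches `p` or `q` (finite check: `v ∈ {(0,0,true), (-1,0,true)}`
and explicit paths). [folklore] -/
private theorem farPort_hv {v p q : HV} (hv : hvGraph.Adj hvOrigin v) (hp : hvGraph.Adj v p)
    (hq : hvGraph.Adj v q) (huv : v ≠ wOut) (hwp : p ≠ hvOrigin) (hpq : p ≠ q)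
    (hwq : q ≠ hvOrigin) :
    (∃ x y : HV, x ≠ hvOrigin ∧ hvGraph.Adj wOut x ∧ hvGraph.Adj x y ∧ hvGraph.Adj y p) ∨
      (∃ x y : HV, x ≠ hvOrigin ∧ hvGraph.Adj wOut x ∧ hvGraph.Adj x y ∧ hvGraph.Adj y q) := by
  have W1 : ((1, -1, false) : HV) ≠ hvOrigin ∧ hvGraph.Adj wOut ((1, -1, false) : HV) ∧
      hvGraph.Adj ((1, -1, false) : HV) ((1, -1, true) : HV) ∧
      hvGraph.Adj ((1, -1, true) : HV) ((1, 0, false) : HV) := by decide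
  have W2 : ((0, -1, false) : HV) ≠ hvOrigin ∧ hvGraph.Adj wOut ((0, -1, false) : HV) ∧
      hvGraph.Adj ((0, -1, false) : HV) ((-1, -1, true) : HV) ∧
      hvGraph.Adj ((-1, -1, true) : HV) ((-1, 0, false) : HV) := by decide
  rw [hvGraph_adj_iff_mem_nbrs] at hv hp hq
  simp [hvOrigin, nbrs] at hv
  rcases hv with rfl | rfl | rfl
  · simp [nbrs] at hp hq
    rcases hp with rfl | rfl | rfl <;> rcases hq with rfl | rfl | rfl <;>
      first
      | exact absurd rfl hwp
      | exact absurd rfl hwq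
      | exact absurd rfl hpq
      | exact Or.inl ⟨_, _, W1⟩
      | exact Or.inr ⟨_, _, W1⟩
  · simp [nbrs] at hp hq
    rcases hp with rfl | rfl | rfl <;> rcases hq with rfl | rfl | rfl <;>
      first
      | exact absurd rfl hwp
      | exact absurd rfl hwq
      | exact absurd rfl hpq
      | exact Or.inl ⟨_, _, W2⟩
      | exact Or.inr ⟨_, _, W2⟩
  · exact absurd rfl huv

/-- Pull-back of a `3`-path of the coordinate model along a chart `Φ : hexGraph ≃g hvGraph` with
`Φ u = wOut`, `Φ w = hvOrigin`. [folklore] -/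
private theorem farPort_pullback (Φ : hexGraph ≃g hvGraph) {u w t : HexVertex} (hΦu : Φ u = wOut)
    (hΦw : Φ w = hvOrigin)
    (h : ∃ x y : HV, x ≠ hvOrigin ∧ hvGraph.Adj wOut x ∧ hvGraph.Adj x y ∧ hvGraph.Adj y (Φ t)) :
    ∃ x y : HexVertex, x ≠ w ∧ hexGraph.Adj u x ∧ hexGraph.Adj x y ∧ hexGraph.Adj y t := by
  obtain ⟨x, y, hxw, hux, hxy, hyt⟩ := h
  refine ⟨Φ.symm x, Φ.symm y, fun hx => hxw ?_, ?_, Φ.symm.map_rel_iff.2 hxy, ?_⟩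
  · rw [← hΦw, ← hx, RelIso.apply_symm_apply]
  · have h1 : hexGraph.Adj (Φ.symm wOut) (Φ.symm x) := Φ.symm.map_rel_iff.2 hux
    rwa [← hΦu, RelIso.symm_apply_apply] at h1
  · have h2 : hexGraph.Adj (Φ.symm y) (Φ.symm (Φ t)) := Φ.symm.map_rel_iff.2 hyt
    rwa [RelIso.symm_apply_apply] at h2

/-- S4 (lattice fact): of the two neighbours `p, q` of the target `v` other than the source vertex `w`, one is the far port
of the entrance `{u, w}` (a `3`-path from `u` avoiding `w` reaches it). Finite check in the coordinate model after a chart.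
[folklore] -/
theorem stub_exists_farPort : ∀ (u w v p q : HexVertex), hexGraph.Adj u w → hexGraph.Adj v w → hexGraph.Adj v p →
    hexGraph.Adj v q → u ≠ v → w ≠ p → p ≠ q → w ≠ q →
    (∃ x y : HexVertex, x ≠ w ∧ hexGraph.Adj u x ∧ hexGraph.Adj x y ∧ hexGraph.Adj y p) ∨
      (∃ x y : HexVertex, x ≠ w ∧ hexGraph.Adj u x ∧ hexGraph.Adj x y ∧ hexGraph.Adj y q) := by
  intro u w v p q huw hvw hvp hvq huv hwp hpq hwq
  obtain ⟨Φ, _, _, _, hΦu, hΦw, _⟩ := exists_chart huw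
  have hv : hvGraph.Adj hvOrigin (Φ v) := by
    rw [← hΦw]
    exact Φ.map_rel_iff.2 hvw.symm
  have hp : hvGraph.Adj (Φ v) (Φ p) := Φ.map_rel_iff.2 hvp
  have hq : hvGraph.Adj (Φ v) (Φ q) := Φ.map_rel_iff.2 hvq
  have huv' : Φ v ≠ wOut := fun h => huv (Φ.injective (hΦu.trans h.symm))
  have hwp' : Φ p ≠ hvOrigin := fun h => hwp (Φ.injective (hΦw.trans h.symm))
  have hpq' : Φ p ≠ Φ q := fun h => hpq (Φ.injective h)
  have hwq' : Φ q ≠ hvOrigin := fun h => hwq (Φ.injective (hΦw.trans h.symm))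
  rcases farPort_hv hv hp hq huv' hwp' hpq' hwq' with h | h
  · exact Or.inl (farPort_pullback Φ hΦu hΦw h)
  · exact Or.inr (farPort_pullback Φ hΦu hΦw h)

end Summit.CriticalPhenomena.SAWScalingLimit.Cruxes.SpinMonotone.AdjacentPort

end
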